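import Literature.NumberTheory.EllipticCurves.IwasawaTowerTorsionProofs
import HarnessLib

/-!
# `E(K)[p] = 0 ⟹ E(K_n)[p] = 0` for the layers of a `ℤ_p`-extension (T-E3g-BUDn, seam (S0))

Cell `b2b-bsdres`, team n1011, seat p10 GEN 4, row T-E3g-BUDn (ROUTE-2 II.17, Option B).  The
K-general level-`0` socket (`exists_finset_layerZero_of_tamagawaWitnesses`, FILE 4b) applied over
the layer `K_n = κ.layer n` needs `E(K_n)[p] = 0` for the base-changed curve; this file derives it
from `E(K)[p] = 0`: a `p`-torsion point of `E(K_n)` maps (injectively, along `K_n ↪ K̄`) to a point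
of `E[p^∞]` fixed by `Gal(K̄/K_n) ⊇ Gal(K̄/K_∞) = ker κ`, and `E[p^∞]^{ker κ} = 0` when `E(K)[p] = 0`
(the tree's `fixedPoints_kerSubgroup_geomPrimaryTorsion_eq_bot`: a `p`-group acting on a non-zero
`p`-group has a non-zero fixed point; Greenberg, LNM 1716, §1 p. 62 and p. 109).
-/

set_option autoImplicit false

noncomputable section

open scoped Classical

open Field WeierstrassCurve Literature.NumberTheory.EllipticCurves

universe u

namespace Summit.BirchSwinnertonDyer.Rank1Residual.Additive

variable {K : Type u} [Field K] (W : WeierstrassCurve K) (p : ℕ) [hp : Fact p.Prime]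

omit hp in
/-- Points over an intermediate field `F ≤ K̄` map to `E(K̄)`, and an element of `Γ_K` fixing `F`
pointwise fixes their images (the action on `E(K̄)` is coordinatewise). [folklore] -/
theorem smul_eq_of_eq_map_val_of_forall_apply_eq (F : IntermediateField K (AlgebraicClosure K))
    (σ : absoluteGaloisGroup K)
    (hσ : ∀ x : AlgebraicClosure K, x ∈ F → (absoluteGaloisGroup.toAlgEquiv K σ) x = x)
    (Q : (W.baseChange F).toAffine.Point) (P : geomPoints W)
    (hPQ : P = Affine.Point.map (W' := W) F.val Q) : σ • P = P := by
  have hcomp : ((absoluteGaloisGroup.toAlgEquiv K σ : AlgebraicClosure K ≃ₐ[K] AlgebraicClosure K) :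
      AlgebraicClosure K →ₐ[K] AlgebraicClosure K).comp F.val = F.val :=
    AlgHom.ext fun x ↦ hσ x.1 x.2
  rw [hPQ]
  change Affine.Point.map (W' := W)
      ((absoluteGaloisGroup.toAlgEquiv K σ : AlgebraicClosure K ≃ₐ[K] AlgebraicClosure K) :
        AlgebraicClosure K →ₐ[K] AlgebraicClosure K) (Affine.Point.map (W' := W) F.val Q) =
      Affine.Point.map (W' := W) F.val Q
  rw [Affine.Point.map_map, hcomp]

variable [NumberField K] [W.IsElliptic] (κ : ZpExtension K p)

/-- **`E(K)[p] = 0 ⟹ E(K_n)[p] = 0`** for every layer `K_n = κ.layer n` of a `ℤ_p`-extension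
`κ` of the number field `K` (points of the base change `E_{K_n}` over the FIELD `K_n`): the image in
`E(K̄)` of a `p`-torsion point of `E(K_n)` lies in `E[p^∞]^{Gal(K̄/K_∞)}`, which is `0`
(`fixedPoints_kerSubgroup_geomPrimaryTorsion_eq_bot`). [cite: GreenbergLNM1716, §1 p. 62; §4 p. 109] -/
theorem eq_zero_of_smul_eq_zero_baseChange_layer
    (hK : ∀ P : W.toAffine.Point, p • P = 0 → P = 0) (n : ℕ)
    (Q : (W.baseChange (κ.layer n)).toAffine.Point) (hQ : p • Q = 0) : Q = 0 := by
  obtain ⟨P, hPQ⟩ : ∃ P : geomPoints W, P = Affine.Point.map (W' := W) (κ.layer n).val Q := ⟨_, rfl⟩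
  apply Affine.Point.map_injective (W' := W) (f := (κ.layer n).val)
  rw [map_zero, ← hPQ]
  have hP : p • P = 0 := by
    rw [hPQ]
    change p • Affine.Point.map (W' := W) (κ.layer n).val Q =
      (0 : (W.baseChange (AlgebraicClosure K)).toAffine.Point)
    rw [← map_nsmul, hQ, map_zero]
  have hprim : P ∈ geomPrimaryTorsion W p :=
    (AddCommGroup.mem_primaryComponent).mpr ⟨1, by rw [pow_one]; exact hP⟩
  have hmem : (⟨P, hprim⟩ : geomPrimaryTorsion W p) ∈
      FixedPoints.addSubgroup κ.kerSubgroup (geomPrimaryTorsion W p) := by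
    rw [FixedPoints.mem_addSubgroup]
    rintro ⟨τ, hτ⟩
    apply Subtype.ext
    change τ • P = P
    refine smul_eq_of_eq_map_val_of_forall_apply_eq W (κ.layer n) τ (fun x hx ↦ ?_) Q P hPQ
    exact (IntermediateField.mem_fixedField_iff _ _).mp hx _
      ⟨τ, κ.kerSubgroup_le_layerSubgroup n hτ, rfl⟩
  rw [W.fixedPoints_kerSubgroup_geomPrimaryTorsion_eq_bot κ hK] at hmem
  exact congrArg Subtype.val (AddSubgroup.mem_bot.mp hmem)

/-- The same in the `∀`-form consumed by the K-general sockets (`hK` of FILE 2 / FILE 4b over `K_n`).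
[cite: GreenbergLNM1716, §1 p. 62] -/
theorem forall_smul_eq_zero_baseChange_layer
    (hK : ∀ P : W.toAffine.Point, p • P = 0 → P = 0) (n : ℕ) :
    ∀ Q : (W.baseChange (κ.layer n)).toAffine.Point, p • Q = 0 → Q = 0 :=
  fun Q hQ ↦ eq_zero_of_smul_eq_zero_baseChange_layer W p κ hK n Q hQ

end Summit.BirchSwinnertonDyer.Rank1Residual.Additive
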